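import Summits.QuantumFields.BalabanUV.Beta.GAN24.ArrowOperator

/-!
# `BalabanUV.Beta.GAN24.ArrowBlockLipschitz` — binder row G-an2-4 / (CONV-C), road P1-fibre, p1 row **P1-L10** `FibreStrip` ((I3′), the strip half of the
# K-slot), leaf-16's cut (M4) `L10-CUT-M4.md` rows **F6 `ArrowOuterShift`** (this seat) and **F4 `ArrowInnerShift`** (leaf-04-g5), SHARED PART 1:
# the KKT block `ArrowOperator.tBlock` is LIPSCHITZ IN ITS SYMBOLS (operator norm ≤ explicit multiple of the sup-norm symbol perturbations)

NOT IN PRINT; OUR PROOF ATTEMPT.  HONEST FRAMING (cell contract, verbatim): «discharging `BetaPertH` makes Bałaban's UV stability UNCONDITIONAL — a real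
constructive-QFT result; it is NOT the continuum limit and NOT the Clay problem.»  HONEST DEPENDENCY (verbatim): «continuum YM on T⁴ ⇐ BetaPertH ∧ nine spine
estimates (0/9 proved); BetaPertH ⇐ (D1) ∧ (D4) ∧ CAP+tail; G-an2-4 gates asym, D1 and NE2/3/4.»  [folklore] finite-dimensional norm bookkeeping over `ℂ` in EXACTLY
leaf-16's F1 currency (`ArrowOperator.tBlock`, p202890; the L2 operator norm `Matrix.Norms.L2Operator` and E1's `BorderedFrameInverseBlocks.opNorm_le_sum_entries`
BY NAME); no cited fact, no wall binder, no `def`, no unit sequence touched (ref2 c2/c3).  NOT summit progress; discharges nothing of the K-slot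
`GAN24.CombesThomas.ConvCK 3 Lc` (it is the block half of the Lipschitz rows F4/F6, themselves two of the four inputs of F7 = (U1)).

## What is proved (generic `D`; symbols `dd db dd' db' : Fin D → ℂ`, `L L' : ℂ`; all bounds SUP-NORM over `κ`, constants DISPLAYED)
* §1 the four entry families of `tBlock dd db L` and of a DIFFERENCE `tBlock dd' db' L' − tBlock dd db L` (`tBlock_apply_*`, `tBlock_sub_apply_*`);
* §2 **`norm_tBlock_sub_le`**: if `‖dd κ‖, ‖dd' κ‖, ‖db' κ‖ ≤ a`, `‖L‖ ≤ ℓ` and `‖dd' κ − dd κ‖, ‖db' κ − db κ‖ ≤ ε`, `‖L' − L‖ ≤ εL`, then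
  `‖tBlock dd' db' L' − tBlock dd db L‖ ≤ 2D·εL + 4D²·a·ε + 2D·(a·εL + ℓ·ε)` (L2 operator norm; via the entry sum);
* §3 `norm_tBlock_le`: `‖tBlock dd db L‖ ≤ 2D·ℓ + 2D²·a·b + D·ℓ·(a + b)` under `‖dd κ‖ ≤ a`, `‖db κ‖ ≤ b`, `‖L‖ ≤ ℓ`.
USE (F4/F6): at a REAL anchor the normalised symbols of `ArrowScaling` have `Σ_κ‖d_κ‖² = 1`, `LN = 1`, so `a = 1 + (shift)`, `ℓ = 1`; under `k ↦ k + h` the symbol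
perturbations `ε, εL` are the F2/Y10g\* strip (resp. polydisc) bounds `O(|h|·N/r_m)`; the border half of F4/F6 is separate (Frobenius sums over aliases).
Unit `b2b-balaban-gan24-formalise-leaf-10` (G-an2-4 formalisation swarm, leaf prover 10, gen 5), 2026-08-20.  Value = bookkeeping toward (I3′), NOT summit progress.
-/

noncomputable section

open Complex Finset Matrix
open scoped BigOperators Matrix.Norms.L2Operator

namespace Summit.QuantumFields.BalabanUV.Beta.GAN24.ArrowBlockLipschitz

open ArrowOperator (Loc tBlock)
open BorderedFrameInverseBlocks (opNorm_le_sum_entries)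

variable {D : ℕ}

/-! ## §1 Entries of a KKT block and of a difference of KKT blocks -/

/-- [folklore] A–A entry: `2((L·[κ = l]) − ∂_κ ∂♭_l)`. -/
theorem tBlock_apply_inl_inl (dd db : Fin D → ℂ) (L : ℂ) (κ l : Fin D) :
    tBlock dd db L (Sum.inl κ) (Sum.inl l) = 2 * ((if κ = l then L else 0) - dd κ * db l) := rfl

/-- [folklore] A–μ entry: `−L ∂_κ`. -/
theorem tBlock_apply_inl_inr (dd db : Fin D → ℂ) (L : ℂ) (κ : Fin D) (u : Unit) :
    tBlock dd db L (Sum.inl κ) (Sum.inr u) = -(L * dd κ) := rfl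

/-- [folklore] G–A entry: `L ∂♭_l`. -/
theorem tBlock_apply_inr_inl (dd db : Fin D → ℂ) (L : ℂ) (u : Unit) (l : Fin D) :
    tBlock dd db L (Sum.inr u) (Sum.inl l) = L * db l := rfl

/-- [folklore] G–μ entry: `0`. -/
theorem tBlock_apply_inr_inr (dd db : Fin D → ℂ) (L : ℂ) (u u' : Unit) :
    tBlock dd db L (Sum.inr u) (Sum.inr u') = 0 := rfl

/-- [folklore] A–A entry of a difference: `2(ΔL·[κ = l] − (∂'_κ∂♭'_l − ∂_κ∂♭_l))`. -/
theorem tBlock_sub_apply_inl_inl (dd db dd' db' : Fin D → ℂ) (L L' : ℂ) (κ l : Fin D) :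
    (tBlock dd' db' L' - tBlock dd db L) (Sum.inl κ) (Sum.inl l)
      = 2 * ((if κ = l then L' - L else 0) - (dd' κ * db' l - dd κ * db l)) := by
  rw [Matrix.sub_apply, tBlock_apply_inl_inl, tBlock_apply_inl_inl]
  split_ifs <;> ring

/-- [folklore] A–μ entry of a difference: `−(L'∂'_κ − L∂_κ)`. -/
theorem tBlock_sub_apply_inl_inr (dd db dd' db' : Fin D → ℂ) (L L' : ℂ) (κ : Fin D) (u : Unit) :
    (tBlock dd' db' L' - tBlock dd db L) (Sum.inl κ) (Sum.inr u) = -(L' * dd' κ - L * dd κ) := by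
  rw [Matrix.sub_apply, tBlock_apply_inl_inr, tBlock_apply_inl_inr]; ring

/-- [folklore] G–A entry of a difference: `L'∂♭'_l − L∂♭_l`. -/
theorem tBlock_sub_apply_inr_inl (dd db dd' db' : Fin D → ℂ) (L L' : ℂ) (u : Unit) (l : Fin D) :
    (tBlock dd' db' L' - tBlock dd db L) (Sum.inr u) (Sum.inl l) = L' * db' l - L * db l := by
  rw [Matrix.sub_apply, tBlock_apply_inr_inl, tBlock_apply_inr_inl]

/-- [folklore] G–μ entry of a difference: `0`. -/
theorem tBlock_sub_apply_inr_inr (dd db dd' db' : Fin D → ℂ) (L L' : ℂ) (u u' : Unit) :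
    (tBlock dd' db' L' - tBlock dd db L) (Sum.inr u) (Sum.inr u') = 0 := by
  rw [Matrix.sub_apply, tBlock_apply_inr_inr, tBlock_apply_inr_inr, sub_zero]

/-! ## §2 The KKT block is Lipschitz in its symbols -/

/-- [folklore] The elementary product-difference bound `‖x'y' − xy‖ ≤ ‖x' − x‖·‖y'‖ + ‖x‖·‖y' − y‖`. -/
theorem norm_mul_sub_mul_le (x y x' y' : ℂ) : ‖x' * y' - x * y‖ ≤ ‖x' - x‖ * ‖y'‖ + ‖x‖ * ‖y' - y‖ := by
  have h : x' * y' - x * y = (x' - x) * y' + x * (y' - y) := by ring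
  rw [h]
  exact (norm_add_le _ _).trans (by rw [norm_mul, norm_mul])

/-- [folklore] **`tBlock` IS LIPSCHITZ IN ITS SYMBOLS** (L2 operator norm, through the entry sum `BorderedFrameInverseBlocks.opNorm_le_sum_entries`):
with sup-norm sizes `‖dd κ‖, ‖dd' κ‖, ‖db' κ‖ ≤ a`, `‖L‖ ≤ ℓ` and sup-norm perturbations `‖dd' κ − dd κ‖, ‖db' κ − db κ‖ ≤ ε`, `‖L' − L‖ ≤ εL`,
`‖tBlock dd' db' L' − tBlock dd db L‖ ≤ 2D·εL + 4D²·a·ε + 2D·(a·εL + ℓ·ε)`. -/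
theorem norm_tBlock_sub_le (dd db dd' db' : Fin D → ℂ) (L L' : ℂ) {a ℓ ε εL : ℝ}
    (ha : 0 ≤ a) (hℓ : 0 ≤ ℓ) (hε : 0 ≤ ε) (hεL : 0 ≤ εL)
    (hdd : ∀ κ, ‖dd κ‖ ≤ a) (hdd' : ∀ κ, ‖dd' κ‖ ≤ a) (hdb' : ∀ κ, ‖db' κ‖ ≤ a) (hL : ‖L‖ ≤ ℓ)
    (hΔdd : ∀ κ, ‖dd' κ - dd κ‖ ≤ ε) (hΔdb : ∀ κ, ‖db' κ - db κ‖ ≤ ε) (hΔL : ‖L' - L‖ ≤ εL) :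
    ‖tBlock dd' db' L' - tBlock dd db L‖ ≤ 2 * D * εL + 4 * D ^ 2 * a * ε + 2 * D * (a * εL + ℓ * ε) := by
  -- entry bounds
  have hAA : ∀ κ l, ‖(tBlock dd' db' L' - tBlock dd db L) (Sum.inl κ) (Sum.inl l)‖ ≤ 2 * ((if κ = l then εL else 0) + 2 * a * ε) := by
    intro κ l
    rw [tBlock_sub_apply_inl_inl, norm_mul, Complex.norm_two]
    refine mul_le_mul_of_nonneg_left ((norm_sub_le _ _).trans (add_le_add ?_ ?_)) zero_le_two
    · split_ifs
      · exact hΔL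
      · simp
    · calc ‖dd' κ * db' l - dd κ * db l‖ ≤ ‖dd' κ - dd κ‖ * ‖db' l‖ + ‖dd κ‖ * ‖db' l - db l‖ := norm_mul_sub_mul_le _ _ _ _
        _ ≤ ε * a + a * ε := add_le_add (mul_le_mul (hΔdd κ) (hdb' l) (norm_nonneg _) hε) (mul_le_mul (hdd κ) (hΔdb l) (norm_nonneg _) ha)
        _ = 2 * a * ε := by ring
  have hAμ : ∀ κ (u : Unit), ‖(tBlock dd' db' L' - tBlock dd db L) (Sum.inl κ) (Sum.inr u)‖ ≤ a * εL + ℓ * ε := by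
    intro κ u
    rw [tBlock_sub_apply_inl_inr, norm_neg]
    calc ‖L' * dd' κ - L * dd κ‖ ≤ ‖L' - L‖ * ‖dd' κ‖ + ‖L‖ * ‖dd' κ - dd κ‖ := norm_mul_sub_mul_le _ _ _ _
      _ ≤ εL * a + ℓ * ε := add_le_add (mul_le_mul hΔL (hdd' κ) (norm_nonneg _) hεL) (mul_le_mul hL (hΔdd κ) (norm_nonneg _) hℓ)
      _ = a * εL + ℓ * ε := by ring
  have hGA : ∀ (u : Unit) l, ‖(tBlock dd' db' L' - tBlock dd db L) (Sum.inr u) (Sum.inl l)‖ ≤ a * εL + ℓ * ε := by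
    intro u l
    rw [tBlock_sub_apply_inr_inl]
    calc ‖L' * db' l - L * db l‖ ≤ ‖L' - L‖ * ‖db' l‖ + ‖L‖ * ‖db' l - db l‖ := norm_mul_sub_mul_le _ _ _ _
      _ ≤ εL * a + ℓ * ε := add_le_add (mul_le_mul hΔL (hdb' l) (norm_nonneg _) hεL) (mul_le_mul hL (hΔdb l) (norm_nonneg _) hℓ)
      _ = a * εL + ℓ * ε := by ring
  -- sum the entries
  have h4 : ‖(tBlock dd' db' L' - tBlock dd db L) (Sum.inr default) (Sum.inr default)‖ = 0 := by
    rw [tBlock_sub_apply_inr_inr, norm_zero]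
  have h1 : ∑ κ : Fin D, ∑ l : Fin D, ‖(tBlock dd' db' L' - tBlock dd db L) (Sum.inl κ) (Sum.inl l)‖
      ≤ 2 * D * εL + 4 * D ^ 2 * a * ε := by
    calc ∑ κ : Fin D, ∑ l : Fin D, ‖(tBlock dd' db' L' - tBlock dd db L) (Sum.inl κ) (Sum.inl l)‖
        ≤ ∑ κ : Fin D, ∑ l : Fin D, 2 * ((if κ = l then εL else 0) + 2 * a * ε) :=
          Finset.sum_le_sum fun κ _ => Finset.sum_le_sum fun l _ => hAA κ l
      _ = ∑ κ : Fin D, (2 * εL + ∑ _l : Fin D, 4 * a * ε) := by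
          refine Finset.sum_congr rfl fun κ _ => ?_
          rw [show (fun l : Fin D => 2 * ((if κ = l then εL else 0) + 2 * a * ε))
              = (fun l : Fin D => (if κ = l then 2 * εL else 0) + 4 * a * ε) from funext fun l => by split_ifs <;> ring,
            Finset.sum_add_distrib, Finset.sum_ite_eq, if_pos (Finset.mem_univ κ)]
      _ = 2 * D * εL + 4 * D ^ 2 * a * ε := by
          rw [Finset.sum_add_distrib, Finset.sum_const, Finset.sum_const, Finset.card_univ, Fintype.card_fin, nsmul_eq_mul,
            Finset.sum_const, Finset.card_univ, Fintype.card_fin, nsmul_eq_mul, nsmul_eq_mul]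
          ring
  have h2 : ∑ κ : Fin D, ‖(tBlock dd' db' L' - tBlock dd db L) (Sum.inl κ) (Sum.inr default)‖ ≤ D * (a * εL + ℓ * ε) := by
    calc ∑ κ : Fin D, ‖(tBlock dd' db' L' - tBlock dd db L) (Sum.inl κ) (Sum.inr default)‖
        ≤ ∑ _κ : Fin D, (a * εL + ℓ * ε) := Finset.sum_le_sum fun κ _ => hAμ κ default
      _ = D * (a * εL + ℓ * ε) := by rw [Finset.sum_const, Finset.card_univ, Fintype.card_fin, nsmul_eq_mul]
  have h3 : ∑ l : Fin D, ‖(tBlock dd' db' L' - tBlock dd db L) (Sum.inr default) (Sum.inl l)‖ ≤ D * (a * εL + ℓ * ε) := by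
    calc ∑ l : Fin D, ‖(tBlock dd' db' L' - tBlock dd db L) (Sum.inr default) (Sum.inl l)‖
        ≤ ∑ _l : Fin D, (a * εL + ℓ * ε) := Finset.sum_le_sum fun l _ => hGA default l
      _ = D * (a * εL + ℓ * ε) := by rw [Finset.sum_const, Finset.card_univ, Fintype.card_fin, nsmul_eq_mul]
  refine (opNorm_le_sum_entries _).trans ?_
  simp only [Fintype.sum_sum_type, Finset.univ_unique, Finset.sum_singleton, Finset.sum_add_distrib]
  linarith [h1, h2, h3, h4]

/-! ## §3 The size of a KKT block -/

/-- [folklore] `‖tBlock dd db L‖ ≤ 2D·ℓ + 2D²·a·b + D·ℓ·(a + b)` under `‖dd κ‖ ≤ a`, `‖db κ‖ ≤ b`, `‖L‖ ≤ ℓ` (L2 operator norm via the entry sum). -/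
theorem norm_tBlock_le (dd db : Fin D → ℂ) (L : ℂ) {a b ℓ : ℝ} (ha : 0 ≤ a) (hℓ : 0 ≤ ℓ)
    (hdd : ∀ κ, ‖dd κ‖ ≤ a) (hdb : ∀ κ, ‖db κ‖ ≤ b) (hL : ‖L‖ ≤ ℓ) :
    ‖tBlock dd db L‖ ≤ 2 * D * ℓ + 2 * D ^ 2 * a * b + D * ℓ * (a + b) := by
  have hAA : ∀ κ l, ‖tBlock dd db L (Sum.inl κ) (Sum.inl l)‖ ≤ (if κ = l then 2 * ℓ else 0) + 2 * a * b := by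
    intro κ l
    rw [tBlock_apply_inl_inl, norm_mul, Complex.norm_two]
    have hp : ‖dd κ * db l‖ ≤ a * b := by rw [norm_mul]; exact mul_le_mul (hdd κ) (hdb l) (norm_nonneg _) ha
    split_ifs
    · calc 2 * ‖L - dd κ * db l‖ ≤ 2 * (‖L‖ + ‖dd κ * db l‖) := by gcongr; exact norm_sub_le _ _
        _ ≤ 2 * (ℓ + a * b) := by gcongr
        _ = 2 * ℓ + 2 * a * b := by ring
    · rw [zero_sub, norm_neg, zero_add]
      linarith
  have hAμ : ∀ κ (u : Unit), ‖tBlock dd db L (Sum.inl κ) (Sum.inr u)‖ ≤ ℓ * a := by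
    intro κ u
    rw [tBlock_apply_inl_inr, norm_neg, norm_mul]
    exact mul_le_mul hL (hdd κ) (norm_nonneg _) hℓ
  have hGA : ∀ (u : Unit) l, ‖tBlock dd db L (Sum.inr u) (Sum.inl l)‖ ≤ ℓ * b := by
    intro u l
    rw [tBlock_apply_inr_inl, norm_mul]
    exact mul_le_mul hL (hdb l) (norm_nonneg _) hℓ
  have h4 : ‖tBlock dd db L (Sum.inr default) (Sum.inr default)‖ = 0 := by rw [tBlock_apply_inr_inr, norm_zero]
  have h1 : ∑ κ : Fin D, ∑ l : Fin D, ‖tBlock dd db L (Sum.inl κ) (Sum.inl l)‖ ≤ 2 * D * ℓ + 2 * D ^ 2 * a * b := by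
    calc ∑ κ : Fin D, ∑ l : Fin D, ‖tBlock dd db L (Sum.inl κ) (Sum.inl l)‖
        ≤ ∑ κ : Fin D, ∑ l : Fin D, ((if κ = l then 2 * ℓ else 0) + 2 * a * b) :=
          Finset.sum_le_sum fun κ _ => Finset.sum_le_sum fun l _ => hAA κ l
      _ = ∑ κ : Fin D, (2 * ℓ + ∑ _l : Fin D, 2 * a * b) := by
          refine Finset.sum_congr rfl fun κ _ => ?_
          rw [Finset.sum_add_distrib, Finset.sum_ite_eq, if_pos (Finset.mem_univ κ)]
      _ = 2 * D * ℓ + 2 * D ^ 2 * a * b := by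
          rw [Finset.sum_add_distrib, Finset.sum_const, Finset.sum_const, Finset.card_univ, Fintype.card_fin, nsmul_eq_mul,
            Finset.sum_const, Finset.card_univ, Fintype.card_fin, nsmul_eq_mul, nsmul_eq_mul]
          ring
  have h2 : ∑ κ : Fin D, ‖tBlock dd db L (Sum.inl κ) (Sum.inr default)‖ ≤ D * (ℓ * a) := by
    calc ∑ κ : Fin D, ‖tBlock dd db L (Sum.inl κ) (Sum.inr default)‖ ≤ ∑ _κ : Fin D, ℓ * a := Finset.sum_le_sum fun κ _ => hAμ κ default
      _ = D * (ℓ * a) := by rw [Finset.sum_const, Finset.card_univ, Fintype.card_fin, nsmul_eq_mul]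
  have h3 : ∑ l : Fin D, ‖tBlock dd db L (Sum.inr default) (Sum.inl l)‖ ≤ D * (ℓ * b) := by
    calc ∑ l : Fin D, ‖tBlock dd db L (Sum.inr default) (Sum.inl l)‖ ≤ ∑ _l : Fin D, ℓ * b := Finset.sum_le_sum fun l _ => hGA default l
      _ = D * (ℓ * b) := by rw [Finset.sum_const, Finset.card_univ, Fintype.card_fin, nsmul_eq_mul]
  refine (opNorm_le_sum_entries _).trans ?_
  simp only [Fintype.sum_sum_type, Finset.univ_unique, Finset.sum_singleton, Finset.sum_add_distrib]
  linarith [h1, h2, h3, h4]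

end Summit.QuantumFields.BalabanUV.Beta.GAN24.ArrowBlockLipschitz

end
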